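import Mathlib
import HarnessLib
import Summits.HubbardSuperconductivity.HubbardSuperconductivity.Theorems.ChiralWindowCwKLChiralWindowKernelOp
import Summits.HubbardSuperconductivity.HubbardSuperconductivity.Theorems.ChiralWindowCwKLChiralWindowD4Unitary
import Summits.HubbardSuperconductivity.HubbardSuperconductivity.Theorems.ChiralWindowCwKLChiralWindowSectorProj
import Summits.HubbardSuperconductivity.HubbardSuperconductivity.Theorems.ChiralWindowCwKLChiralWindowSectorKernel
import Summits.HubbardSuperconductivity.HubbardSuperconductivity.Theorems.ChiralWindowCwKLChiralWindowKernelHS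
import Summits.HubbardSuperconductivity.HubbardSuperconductivity.Theorems.ChiralWindowCwKLChiralWindowLindhardD4

/-!
# Crux `CwKLChiralWindow` (stmt-1741), line `Sketch`: the operator package of one symmetry channel

For `μ ∈ (-4,0)`, a channel `χ`, the BASE KERNEL `κ(k,q) = c_U + χ₀(k+q)` (`c_U ∈ {0,1}`; `c_U = 1` only for
`A1g`, where it is the bare-`U` term of the `U = 1` Kohn–Luttinger vertex) and an admissible deflation
`Σ_m c_m u_m ⊗ u_m` (`c_m ≥ 0`, `u_m ∈ L²(σ_μ)` channel-`χ` functions), this file assembles — from the landed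
stubs `stub_klKernelOp`, `stub_klD4Unitary`, `stub_klSectorProj`, `stub_klSectorKernel` — the objects the certificate
logic works with, as ONE existential statement `stub_klChannelOps`:

* `A` — the integral operator of `κ` on `L²(σ_μ)` (a.e. action, matrix elements, self-adjoint, compact);
* `P` — the isotypic projection of `χ` (commutes with `A`, `P² = P = P*`, fixes channel functions, its range
  consists of classes of channel functions);
* `U₁` — the quarter turn (commutes with `A` and `P`, isometric, `⟪v, U₁ v⟫ = 0` on the `E` sector);
* the DEFLATED HILBERT–SCHMIDT FAMILY BOUND: for every finite orthonormal family `(f_j)` of `P`-fixed vectors,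
  `Σ_j ‖A f_j - B f_j‖² ≤ ∫∫ (d4Project χ (κ(k, ·)) k' - Σ_m c_m u_m(k) u_m(k'))² d(σ⊗σ)`, `B = Σ c_m ⟨u_m,·⟩ u_m ≥ 0`.
-/

noncomputable section

set_option linter.dupNamespace false

namespace Summit.HubbardSuperconductivity.HubbardSuperconductivity.Theorems

open MeasureTheory Literature.MathematicalPhysics.QuantumLattice

/-- `d4Momentum g` is additive (the generators `rot`, `refl` are linear). [folklore] -/
theorem kl_co_d4Momentum_add (g : DihedralGroup 4) (p q : Momentum) :
    d4Momentum g (p + q) = d4Momentum g p + d4Momentum g q := by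
  have hiter : ∀ (n : ℕ) (p q : Momentum), rotMomentum^[n] (p + q) = rotMomentum^[n] p + rotMomentum^[n] q := by
    intro n
    induction n with
    | zero => intro p q; rfl
    | succ n ih =>
      intro p q
      rw [Function.iterate_succ_apply', Function.iterate_succ_apply', Function.iterate_succ_apply', ih,
        kl_ld4_rot_add]
  cases g with
  | r i => exact hiter i.val p q
  | sr i =>
    change reflMomentum (rotMomentum^[i.val] (p + q)) =
      reflMomentum (rotMomentum^[i.val] p) + reflMomentum (rotMomentum^[i.val] q)
    rw [hiter, kl_ld4_refl_add]

/-- The base kernel `c + χ₀(k + q)` is `D₄`-invariant in both variables jointly. [folklore] -/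
theorem kl_co_baseKernel_invariant (μ c : ℝ) (g : DihedralGroup 4) (k q : Momentum) :
    c + lindhardFunction (squareDispersion 1 0) μ (d4Momentum g k + d4Momentum g q) =
      c + lindhardFunction (squareDispersion 1 0) μ (k + q) := by
  rw [← kl_co_d4Momentum_add, stub_klLindhardD4]

/-- The base kernel `(k, q) ↦ c + χ₀(k + q)` is square integrable on `σ_μ ⊗ σ_μ` for `μ ∈ (-4,0)`. [folklore] -/
theorem kl_co_baseKernel_memLp {μ : ℝ} (hμ : μ ∈ Set.Ioo (-4 : ℝ) 0) (c : ℝ) :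
    MemLp (Function.uncurry fun k q : Momentum => c + lindhardFunction (squareDispersion 1 0) μ (k + q)) 2
      ((fermiCurveMeasure (squareDispersion 1 0) μ).prod (fermiCurveMeasure (squareDispersion 1 0) μ)) := by
  haveI : IsFiniteMeasure (fermiCurveMeasure (squareDispersion 1 0) μ) :=
    stub_klFiniteMeasure stub_klGradient stub_klHausdorffFinite μ hμ
  exact (memLp_const c).add (stub_klKernelHS μ hμ)

/-- On the `E` sector the quarter turn is skew: if `P_E v = v` with `P_E = (1 - U_{r²})/2` then `U_{r²} v = -v`, and for
an isometric anti-multiplicative family (`U_g U_h = U_{hg}`) `⟪v, U_{r} v⟫ = ⟪U_r v, U_{r²} v⟫ = -⟪U_r v, v⟫`, so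
`⟪v, U_r v⟫ = 0`. [folklore] -/
theorem kl_co_inner_rot_eq_zero {H : Type*} [NormedAddCommGroup H] [InnerProductSpace ℝ H]
    (U : DihedralGroup 4 → (H →L[ℝ] H)) (hmul : ∀ g h, U g * U h = U (h * g))
    (hinner : ∀ (g : DihedralGroup 4) (φ ψ : H), inner ℝ (U g φ) (U g ψ) = inner ℝ φ ψ)
    {P : H →L[ℝ] H} (hPE : P = (1 / 2 : ℝ) • (1 - U (DihedralGroup.r 2))) {v : H} (hv : P v = v) :
    inner ℝ v (U (DihedralGroup.r 1) v) = 0 := by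
  have h2 : U (DihedralGroup.r 2) v = -v := by
    have h1 : (1 / 2 : ℝ) • v - (1 / 2 : ℝ) • U (DihedralGroup.r 2) v = v := by
      have := hv
      rw [hPE] at this
      simpa [smul_sub] using this
    have h3 : (1 / 2 : ℝ) • U (DihedralGroup.r 2) v = (1 / 2 : ℝ) • v - v := by
      rw [eq_sub_iff_add_eq, add_comm]
      exact (sub_eq_iff_eq_add.1 h1).symm
    have h4 : (1 / 2 : ℝ) • v - v = (1 / 2 : ℝ) • (-v) := by
      rw [smul_neg]
      have : (1 / 2 : ℝ) • v - v = ((1 / 2 : ℝ) - 1) • v := by rw [sub_smul, one_smul]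
      rw [this, show ((1 / 2 : ℝ) - 1) = -(1 / 2 : ℝ) by norm_num, neg_smul]
    rw [h4] at h3
    exact smul_right_injective H (show (1 / 2 : ℝ) ≠ 0 by norm_num) h3
  have hsq : U (DihedralGroup.r 1) (U (DihedralGroup.r 1) v) = U (DihedralGroup.r 2) v := by
    change (U (DihedralGroup.r 1) * U (DihedralGroup.r 1)) v = _
    rw [hmul]
    rfl
  have h5 : inner ℝ v (U (DihedralGroup.r 1) v) =
      inner ℝ (U (DihedralGroup.r 1) v) (U (DihedralGroup.r 1) (U (DihedralGroup.r 1) v)) :=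
    (hinner (DihedralGroup.r 1) v _).symm
  rw [hsq, h2, inner_neg_right] at h5
  have h6 : inner ℝ (U (DihedralGroup.r 1) v) v = 0 := by
    rw [real_inner_comm] at h5; linarith
  rwa [real_inner_comm] at h6

/-- **The operator package of a symmetry channel** (`stub_klChannelOps`). For `μ ∈ (-4,0)`, a channel `χ`, a flag `withU`
(allowed only for `A1g`) and an admissible deflation `(c_m ≥ 0, u_m ∈ L²(σ_μ))`: there are bounded operators `A`, `P`,
`U₁` on `L²(σ_μ)` such that `A` acts a.e. by the base kernel `κ(k,q) = [withU] + χ₀(k+q)` (with the matrix-element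
formula, self-adjoint, compact), `P` is the isotypic projection of `χ` (a.e. `d4Project χ`, idempotent, self-adjoint,
commuting with `A`, fixing channel functions, with channel representatives on its range), `U₁` is the quarter turn
(a.e. composition with `rot`, commuting with `A` and `P`, isometric, skew on the `E` sector), and the deflated
Hilbert–Schmidt family bound holds on `P`-fixed orthonormal families, the deflation being a positive form. [folklore] -/
theorem stub_klChannelOps : ∀ μ ∈ Set.Ioo (-4 : ℝ) 0, ∀ (χ : D4Irrep) (withU : Bool) (M : ℕ) (c : Fin M → ℝ)
    (u : Fin M → Momentum → ℝ) (hu : ∀ m, MemLp (u m) 2 (fermiCurveMeasure (squareDispersion 1 0) μ)),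
    (withU = true → χ = D4Irrep.A1g) → (∀ m, 0 ≤ c m) →
    ∃ A P U₁ : Lp ℝ 2 (fermiCurveMeasure (squareDispersion 1 0) μ) →L[ℝ] Lp ℝ 2 (fermiCurveMeasure (squareDispersion 1 0) μ),
      (∀ φ : Lp ℝ 2 (fermiCurveMeasure (squareDispersion 1 0) μ),
        (A φ : Momentum → ℝ) =ᵐ[fermiCurveMeasure (squareDispersion 1 0) μ]
          fun k => ∫ k', ((if withU then 1 else 0) + lindhardFunction (squareDispersion 1 0) μ (k + k')) * φ k'
            ∂fermiCurveMeasure (squareDispersion 1 0) μ) ∧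
      (∀ φ ψ : Lp ℝ 2 (fermiCurveMeasure (squareDispersion 1 0) μ),
        inner ℝ ψ (A φ) = ∫ k, ψ k * ∫ k', ((if withU then 1 else 0) +
            lindhardFunction (squareDispersion 1 0) μ (k + k')) * φ k'
          ∂fermiCurveMeasure (squareDispersion 1 0) μ ∂fermiCurveMeasure (squareDispersion 1 0) μ) ∧
      IsSelfAdjoint A ∧ IsCompactOperator A ∧
      A * P = P * A ∧ P * P = P ∧ IsSelfAdjoint P ∧
      (∀ φ : Lp ℝ 2 (fermiCurveMeasure (squareDispersion 1 0) μ),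
        (P φ : Momentum → ℝ) =ᵐ[fermiCurveMeasure (squareDispersion 1 0) μ] fun k => d4Project χ φ k) ∧
      (∀ (ψ : Momentum → ℝ) (hψ : MemLp ψ 2 (fermiCurveMeasure (squareDispersion 1 0) μ)),
        InChannel χ ψ → P (hψ.toLp ψ) = hψ.toLp ψ) ∧
      (∀ φ : Lp ℝ 2 (fermiCurveMeasure (squareDispersion 1 0) μ), P φ = φ →
        ∃ ψ : Momentum → ℝ, InChannel χ ψ ∧ MemLp ψ 2 (fermiCurveMeasure (squareDispersion 1 0) μ) ∧
          (φ : Momentum → ℝ) =ᵐ[fermiCurveMeasure (squareDispersion 1 0) μ] ψ) ∧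
      (∀ φ : Lp ℝ 2 (fermiCurveMeasure (squareDispersion 1 0) μ),
        (U₁ φ : Momentum → ℝ) =ᵐ[fermiCurveMeasure (squareDispersion 1 0) μ] fun k => φ (rotMomentum k)) ∧
      A * U₁ = U₁ * A ∧ P * U₁ = U₁ * P ∧
      (∀ φ ψ : Lp ℝ 2 (fermiCurveMeasure (squareDispersion 1 0) μ), inner ℝ (U₁ φ) (U₁ ψ) = inner ℝ φ ψ) ∧
      (χ = D4Irrep.E → ∀ v : Lp ℝ 2 (fermiCurveMeasure (squareDispersion 1 0) μ), P v = v → inner ℝ v (U₁ v) = 0) ∧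
      (∀ (m : ℕ) (f : Fin m → Lp ℝ 2 (fermiCurveMeasure (squareDispersion 1 0) μ)), Orthonormal ℝ f →
        (∀ j, P (f j) = f j) →
        ∑ j, ‖A (f j) - (∑ m, c m • (innerSL ℝ ((hu m).toLp (u m))).smulRight ((hu m).toLp (u m))) (f j)‖ ^ 2 ≤
          ∫ z, (d4Project χ (fun q => (if withU then 1 else 0) + lindhardFunction (squareDispersion 1 0) μ (z.1 + q)) z.2 -
              ∑ m, c m * (u m z.1 * u m z.2)) ^ 2
            ∂(fermiCurveMeasure (squareDispersion 1 0) μ).prod (fermiCurveMeasure (squareDispersion 1 0) μ)) ∧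
      (∀ φ : Lp ℝ 2 (fermiCurveMeasure (squareDispersion 1 0) μ),
        0 ≤ inner ℝ φ ((∑ m, c m • (innerSL ℝ ((hu m).toLp (u m))).smulRight ((hu m).toLp (u m))) φ)) := by
  intro μ hμ χ withU M c u hu hU hc
  haveI : IsFiniteMeasure (fermiCurveMeasure (squareDispersion 1 0) μ) :=
    stub_klFiniteMeasure stub_klGradient stub_klHausdorffFinite μ hμ
  have hT : ∀ g : DihedralGroup 4, MeasurePreserving (d4Momentum g)
      (fermiCurveMeasure (squareDispersion 1 0) μ) (fermiCurveMeasure (squareDispersion 1 0) μ) :=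
    stub_klD4Invariant stub_klGradient μ hμ
  -- the base kernel and its operator
  set cU : ℝ := if withU then 1 else 0 with hcU
  have hκ2 := kl_co_baseKernel_memLp hμ cU
  obtain ⟨⟨A, hA⟩, hAprops⟩ :=
    stub_klKernelOp μ hμ (fun k q : Momentum => cU + lindhardFunction (squareDispersion 1 0) μ (k + q)) hκ2
  obtain ⟨hAc, hAsa', hHS, hAinner⟩ := hAprops A hA
  have hAsa : IsSelfAdjoint A := hAsa' fun k q => by rw [add_comm k q]
  -- the composition operators and the projection
  obtain ⟨U, hUae, hUmem, hU1, hUmul, hUinner, hUadj, hUcomm⟩ := stub_klD4Unitary μ hμ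
  have hAU : ∀ g : DihedralGroup 4, A * U g = U g * A :=
    hUcomm (fun k q : Momentum => cU + lindhardFunction (squareDispersion 1 0) μ (k + q)) A
      (fun g k q => kl_co_baseKernel_invariant μ cU g k q) hκ2 hA
  obtain ⟨P, hPdef, hPae, hPP, hPsa, hPU, hPfix, hPrepr, hPE⟩ := stub_klSectorProj μ hμ U hUae hU1 hUmul hUadj χ
  have hAP : A * P = P * A := by
    rw [hPdef, mul_smul_comm, smul_mul_assoc, Finset.mul_sum, Finset.sum_mul]
    congr 1
    refine Finset.sum_congr rfl fun g _ => ?_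
    rw [mul_smul_comm, smul_mul_assoc, hAU g]
  -- the deflated sector kernel (abstract helper of …SectorKernel, with the base kernel in place of `χ₀`)
  have hproj : ∀ (ψ : Momentum → ℝ) (k : Momentum),
      d4Project χ ψ k = (χ.dim / 8 : ℝ) * ∑ g, χ.char g * ψ (d4Momentum g k) := fun _ _ => rfl
  have hK'2 := kl_sk_kernel_memLp hT hproj hκ2 c hu
  have hK'ae := fun φ => kl_sk_kernel_ae hT kl_du_d4Momentum_mul d4Momentum_one (kl_sp_char_inv χ) hproj hκ2 hA hPae c hu φ
  have hHS' := (stub_klKernelOp μ hμ _ hK'2).2 _ hK'ae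
  refine ⟨A, P, U (DihedralGroup.r 1), hA, hAinner, hAsa, hAc, hAP, hPP, hPsa, hPae, hPfix, hPrepr,
    fun φ => hUae (DihedralGroup.r 1) φ, hAU _, (hPU _).symm, hUinner _, ?_, ?_,
    fun φ => kl_sk_finiteRank_nonneg hc _ φ⟩
  · intro hE v hv
    exact kl_co_inner_rot_eq_zero U hUmul hUinner (hPE hE) hv
  · intro m f hf hfix
    have h1 := hHS'.2.2.1 m f hf
    refine le_of_eq_of_le (Finset.sum_congr rfl fun j _ => ?_) h1
    rw [sub_apply, mul_apply_eq_comp]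
    change _ = ‖A (P (f j)) - _‖ ^ 2
    rw [hfix j]

end Summit.HubbardSuperconductivity.HubbardSuperconductivity.Theorems

end
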